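import Literature.NumberTheory.LFunctions.XiHigherDerivativesCriticalStrip
import HarnessLib

/-!
# A wrong-sign Laguerre dip of `Ξ` lies in a Jensen disc (item `DipInJensenDisc`, stmt-RiemannHypothesis-23303)

RH-FREE, unconditional.  Route `LaguerreSpeiserSplit` (line «jensen-shadow» of crux C′ =
`LaguerreSignAtCriticalPoints`, stmt-RiemannHypothesis-23196).  Nothing here bears on the truth of RH,
and RH is not proved by this file.

**Statement (item, verbatim).** If `c ∈ ℝ` is a critical point of `t ↦ Re Ξ(t)` with `Ξ(c) ≠ 0` and the
WRONG Laguerre sign `Ξ(c) · Ξ″(c) ≥ 0`, then some non-real zero `ρ` of `Ξ` has `c` in its closed Jensen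
disc: `|c − Re ρ| ≤ |Im ρ|`.

**Proof (Hadamard-free; the real-axis form of Jensen's circle theorem / Laguerre's inequality).**
Suppose `c` lies strictly outside every closed Jensen disc.  The zeros of `Ξ` have `|Im| < ½`, so by
compactness there is a uniform margin `δ > 0`: `|Im a| + δ ≤ |c − Re a|` for every zero `a`
(`exists_margin_riemannXiUpper`).  Hence every `w` with `‖w − c‖ < δ`, `Im w > 0` is strictly outside all
closed discs, and the tree's pair-sign lemma `XiDerivStrip.im_mul_im_logDeriv_neg` (Ki–Kim 2000 §2, the
body of Jensen's theorem) gives `Im (Ξ′/Ξ)(w) < 0` there (`eventually_im_logDeriv_neg`).  The local Pick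
argument of `LaguerreSep.re_deriv_logDeriv_neg` (Boas 1954, Thm 2.8.1), which only ever uses that sign
NEAR the real point, then yields `Re (Ξ′/Ξ)′(c) < 0` (`re_deriv_logDeriv_neg_of_eventually`), i.e. the
strict Laguerre inequality `Ξ(c) Ξ″(c) < Ξ′(c)² = 0` — contradiction.

Sources: H. Ki, Y.-O. Kim, Duke Math. J. 104 (2000) §2 (Jensen's theorem); R. P. Boas, *Entire
Functions* (1954) Thm 2.8.1; G. Csordas, A. Ruttan, R. S. Varga, Numer. Algorithms 1 (1991) (Laguerre
difference violations localise non-real zeros); J. L. W. V. Jensen, Acta Math. 36 (1913).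
-/

-- `Summit.RiemannHypothesis.RiemannHypothesis.…` repeats a component by the tree's layout (D-0017).
set_option linter.dupNamespace false

noncomputable section

namespace Summit.RiemannHypothesis.RiemannHypothesis.Theorems.DipInJensenDisc

open Complex Filter Set Metric Topology
open scoped Real ComplexConjugate
open Literature.Analysis.Complex Literature.NumberTheory.LFunctions

variable {f : ℂ → ℂ}

/-! ## §1. Generic engine: the localised Laguerre–Pick argument -/

/-- `((a : ℝ) * X).im = a * X.im`. -/
theorem im_ofReal_mul_eq (a : ℝ) (X : ℂ) : ((a : ℂ) * X).im = a * X.im := by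
  simp [Complex.mul_im]

/-- **Localised Laguerre–Pick lemma: `(f′/f)′(x₀) < 0`.**  Let `f` be entire and real on `ℝ`, `x₀ ∈ ℝ`
with `f(x₀) ≠ 0`, and suppose `Im (f′/f)(w) < 0` for all `w` with `Im w > 0` in SOME neighbourhood of
`x₀`.  Then `(f′/f)′(x₀)` is real and strictly negative.  (If `g − g(x₀)`, `g = f′/f`, vanished to order
`k ≥ 2` at `x₀`, or to order `1` with positive coefficient, `Im g` would take positive values just above
`x₀`.)  This is `LaguerreSep.re_deriv_logDeriv_neg` (Boas 1954, Thm 2.8.1) with its half-plane hypothesis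
localised; no growth hypothesis is needed here. -/
theorem re_deriv_logDeriv_neg_of_eventually (hf : Differentiable ℂ f)
    (hreal : ∀ x : ℝ, (f x).im = 0) {x₀ : ℝ} (hx : f x₀ ≠ 0)
    (hneg : ∀ᶠ w in 𝓝 (x₀ : ℂ), 0 < w.im → (deriv f w / f w).im < 0) :
    (deriv (fun z ↦ deriv f z / f z) x₀).re < 0 ∧ (deriv (fun z ↦ deriv f z / f z) x₀).im = 0 := by
  set g : ℂ → ℂ := fun z ↦ deriv f z / f z with hg
  have hga : AnalyticAt ℂ g x₀ := ((hf.analyticAt _).deriv).div (hf.analyticAt _) hx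
  have hgreal : ∀ x : ℝ, (g x).im = 0 := fun x ↦ by
    simp only [hg]
    rw [Complex.div_im, hreal x, im_deriv_ofReal hf hreal x]
    ring
  set G : ℂ → ℂ := fun z ↦ g z - g x₀ with hG
  have hGa : AnalyticAt ℂ G x₀ := hga.sub analyticAt_const
  have hGim : ∀ z, (G z).im = (g z).im := fun z ↦ by
    simp only [hG, sub_im, hgreal x₀, sub_zero]
  by_cases hzero : ∀ᶠ z in 𝓝 (x₀ : ℂ), G z = 0
  · exfalso
    obtain ⟨ε, hε, hball⟩ := Metric.eventually_nhds_iff.1 (hzero.and hneg)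
    set w : ℂ := (x₀ : ℂ) + (ε / 2 : ℝ) * I with hw
    have hwim : w.im = ε / 2 := by simp [hw]
    have hdist : dist w x₀ < ε := by
      rw [dist_eq_norm, hw, add_sub_cancel_left, norm_mul, Complex.norm_real, Complex.norm_I, mul_one,
        Real.norm_eq_abs, abs_of_pos (by positivity)]
      linarith
    have h0 := (hball hdist).1
    have h1 := (hball hdist).2 (by rw [hwim]; positivity)
    rw [← hGim, h0, zero_im] at h1
    exact lt_irrefl _ h1
  obtain ⟨n, u, hu, hu0, hGeq⟩ := hGa.exists_eventuallyEq_pow_smul_nonzero_iff.2 hzero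
  -- `n ≥ 1` since `G x₀ = 0`
  have hn : n ≠ 0 := by
    rintro rfl
    have h := hGeq.self_of_nhds
    simp only [hG, sub_self, pow_zero, one_smul] at h
    exact hu0 h.symm
  -- `u x₀` is real: `u = G/(· − x₀)^n` on the punctured real axis
  have huim : (u x₀).im = 0 := by
    have hcont : Tendsto (fun x : ℝ ↦ (u x).im) (𝓝[≠] x₀) (𝓝 (u x₀).im) := by
      have h1 : Tendsto (fun x : ℝ ↦ u x) (𝓝 x₀) (𝓝 (u x₀)) :=
        hu.continuousAt.tendsto.comp (Complex.continuous_ofReal.tendsto x₀)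
      exact (Complex.continuous_im.tendsto _).comp (h1.mono_left nhdsWithin_le_nhds)
    have hev : ∀ᶠ x : ℝ in 𝓝[≠] x₀, (u x).im = 0 := by
      have h1 : ∀ᶠ x : ℝ in 𝓝 x₀, G x = ((x : ℂ) - x₀) ^ n • u x :=
        (Complex.continuous_ofReal.tendsto x₀).eventually hGeq
      have h2 : ∀ᶠ x : ℝ in 𝓝[≠] x₀, x ≠ x₀ := self_mem_nhdsWithin
      filter_upwards [h1.filter_mono nhdsWithin_le_nhds, h2] with x hx hx'
      have hd : ((x : ℂ) - x₀) ^ n ≠ 0 := pow_ne_zero _ (sub_ne_zero.2 (by exact_mod_cast hx'))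
      have hux : u x = G x / ((x : ℂ) - x₀) ^ n := by
        rw [hx, smul_eq_mul]; field_simp
      rw [hux, show ((x : ℂ) - x₀) ^ n = (((x - x₀) ^ n : ℝ) : ℂ) by push_cast; ring,
        Complex.div_ofReal_im, hGim, hgreal x, zero_div]
    have h3 : Tendsto (fun x : ℝ ↦ (u x).im) (𝓝[≠] x₀) (𝓝 0) :=
      tendsto_const_nhds.congr' (hev.mono fun x hx ↦ hx.symm)
    exact tendsto_nhds_unique hcont h3
  -- the key contradiction: a direction `θ ∈ (0, π)` with `sin(nθ) · Re u(x₀) > 0` is impossible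
  have key : ∀ θ : ℝ, 0 < θ → θ < π → 0 < Real.sin (n * θ) * (u x₀).re → False := by
    intro θ hθ0 hθπ hc
    set c : ℝ := Real.sin (n * θ) * (u x₀).re with hcdef
    set z : ℝ → ℂ := fun r ↦ (x₀ : ℂ) + r * exp (θ * I) with hz
    have hzt : Tendsto z (𝓝[>] 0) (𝓝 (x₀ : ℂ)) := by
      have h1 : Continuous z := by
        simp only [hz]
        exact continuous_const.add (Complex.continuous_ofReal.mul continuous_const)
      have h2 := h1.tendsto 0
      simp only [hz, ofReal_zero, zero_mul, add_zero] at h2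
      exact h2.mono_left nhdsWithin_le_nhds
    have h1 : ∀ᶠ r in 𝓝[>] (0 : ℝ), G (z r) = (z r - x₀) ^ n • u (z r) := hzt.eventually hGeq
    have h4 : ∀ᶠ r in 𝓝[>] (0 : ℝ), 0 < (z r).im → (g (z r)).im < 0 := hzt.eventually hneg
    have hlim : Tendsto (fun r ↦ (exp (n * (θ * I)) * u (z r)).im) (𝓝[>] (0 : ℝ))
        (𝓝 (exp (n * (θ * I)) * u x₀).im) :=
      (Complex.continuous_im.tendsto _).comp
        ((continuous_const.mul continuous_id).continuousAt.tendsto.comp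
          (hu.continuousAt.tendsto.comp hzt))
    have hcval : (exp (n * (θ * I)) * u x₀).im = c := by
      rw [show (n : ℂ) * (θ * I) = ((n * θ : ℝ) : ℂ) * I by push_cast; ring, Complex.mul_im,
        Complex.exp_ofReal_mul_I_re, Complex.exp_ofReal_mul_I_im, huim, mul_zero, zero_add, hcdef]
    rw [hcval] at hlim
    have h2 : ∀ᶠ r in 𝓝[>] (0 : ℝ), c / 2 < (exp (n * (θ * I)) * u (z r)).im :=
      hlim.eventually (Ioi_mem_nhds (by linarith))
    have h3 : ∀ᶠ r in 𝓝[>] (0 : ℝ), 0 < r := self_mem_nhdsWithin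
    obtain ⟨r, hr1, hr2, hr3, hr4⟩ := (h1.and (h2.and (h3.and h4))).exists
    have hzr : z r - x₀ = (r : ℂ) * exp (θ * I) := by simp [hz]
    have hpow : (z r - x₀) ^ n = ((r ^ n : ℝ) : ℂ) * exp (n * (θ * I)) := by
      rw [hzr, mul_pow, Complex.exp_nat_mul]; push_cast; ring
    have hGpos : 0 < (G (z r)).im := by
      rw [hr1, smul_eq_mul, hpow, mul_assoc, im_ofReal_mul_eq]
      exact mul_pos (pow_pos hr3 n) (by linarith)
    have hzim : 0 < (z r).im := by
      have : (z r).im = r * Real.sin θ := by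
        simp [hz, Complex.mul_im, Complex.exp_ofReal_mul_I_re, Complex.exp_ofReal_mul_I_im]
      rw [this]
      exact mul_pos hr3 (Real.sin_pos_of_pos_of_lt_pi hθ0 hθπ)
    have := hr4 hzim
    rw [← hGim] at this
    linarith
  have hn1 : 1 ≤ n := Nat.one_le_iff_ne_zero.2 hn
  have hnpos : (0 : ℝ) < n := by exact_mod_cast hn1
  have hre_ne : (u x₀).re ≠ 0 := fun h ↦ hu0 (Complex.ext (by simpa using h) (by simpa using huim))
  -- `Re u(x₀) > 0` is impossible (`θ = π/(2n)`)
  have hre_neg : (u x₀).re < 0 := by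
    rcases lt_or_gt_of_ne hre_ne with h | h
    · exact h
    · exfalso
      have hn1' : (1 : ℝ) ≤ n := by exact_mod_cast hn1
      refine key (π / (2 * n)) (by positivity) ?_ ?_
      · rw [div_lt_iff₀ (by positivity)]; nlinarith [Real.pi_pos]
      · rw [show (n : ℝ) * (π / (2 * n)) = π / 2 by field_simp, Real.sin_pi_div_two, one_mul]
        exact h
  -- `n ≥ 2` is impossible (`θ = 3π/(2n)`)
  have hn_eq : n = 1 := by
    by_contra hne
    have hn2 : (2 : ℝ) ≤ n := by exact_mod_cast (show 2 ≤ n by omega)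
    refine key (3 * π / (2 * n)) (by positivity) ?_ ?_
    · rw [div_lt_iff₀ (by positivity)]; nlinarith [Real.pi_pos]
    · rw [show (n : ℝ) * (3 * π / (2 * n)) = π / 2 + π by field_simp; ring, Real.sin_add_pi,
        Real.sin_pi_div_two]
      linarith
  subst hn_eq
  -- `deriv g x₀ = u x₀`
  have hGd : HasDerivAt G (u x₀) x₀ := by
    have hc0 : HasDerivAt (fun z : ℂ ↦ z - x₀) 1 (x₀ : ℂ) := (hasDerivAt_id (x₀ : ℂ)).sub_const _
    have hc : HasDerivAt (fun z : ℂ ↦ (z - x₀) ^ 1) (((1 : ℕ) : ℂ) * ((x₀ : ℂ) - x₀) ^ (1 - 1) * 1)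
        (x₀ : ℂ) := hc0.pow 1
    have h1 := hc.smul hu.differentiableAt.hasDerivAt
    have hval : ((x₀ : ℂ) - x₀) ^ 1 • deriv u x₀ +
        (((1 : ℕ) : ℂ) * ((x₀ : ℂ) - x₀) ^ (1 - 1) * 1) • u x₀ = u x₀ := by simp
    rw [hval] at h1
    exact h1.congr_of_eventuallyEq hGeq
  have hgd : deriv g x₀ = u x₀ := by
    have h1 : g = fun z ↦ G z + g x₀ := by funext z; simp [hG]
    rw [h1, deriv_add_const, hGd.deriv]
  refine ⟨?_, ?_⟩
  · show (deriv g x₀).re < 0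
    rw [hgd]; exact hre_neg
  · show (deriv g x₀).im = 0
    rw [hgd]; exact huim

/-- **Local half-plane sign from a uniform Jensen margin.**  Let `f` be real entire of order `< 2`
with at least one zero, and let `x₀ ∈ ℝ` lie outside every closed Jensen disc with a uniform margin
`δ > 0`: `|Im a| + δ ≤ |x₀ − Re a|` for every zero `a` of `f`.  Then `Im (f′/f)(w) < 0` for all `w` with
`‖w − x₀‖ < δ` and `Im w > 0` (such `w` are strictly outside all closed discs, and the pair-sign body of
Jensen's theorem `XiDerivStrip.im_mul_im_logDeriv_neg`, Ki–Kim 2000 §2, applies). -/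
theorem eventually_im_logDeriv_neg (hf : Differentiable ℂ f) {ρ C : ℝ} (hρ0 : 0 ≤ ρ) (hρ : ρ < 2)
    (hgr : ∀ z, ‖f z‖ ≤ C * Real.exp (‖z‖ ^ ρ)) (hreal : ∀ x : ℝ, (f x).im = 0)
    (hex : ∃ a, f a = 0) {x₀ δ : ℝ} (hδ : 0 < δ)
    (hout : ∀ a, f a = 0 → |a.im| + δ ≤ |x₀ - a.re|) :
    ∀ᶠ w in 𝓝 (x₀ : ℂ), 0 < w.im → (deriv f w / f w).im < 0 := by
  filter_upwards [Metric.ball_mem_nhds (x₀ : ℂ) hδ] with w hw hwim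
  have hwx : |w.re - x₀| < δ := by
    have h1 : |(w - x₀).re| ≤ ‖w - (x₀ : ℂ)‖ := Complex.abs_re_le_norm _
    have h2 : (w - (x₀ : ℂ)).re = w.re - x₀ := by simp
    rw [h2] at h1
    exact h1.trans_lt (mem_ball_iff_norm.1 hw)
  have hout' : ∀ a, f a = 0 → |a.im| < ‖w - a.re‖ := by
    intro a ha
    have h1 : |(w - a.re).re| ≤ ‖w - (a.re : ℂ)‖ := Complex.abs_re_le_norm _
    have h2 : (w - (a.re : ℂ)).re = w.re - a.re := by simp
    rw [h2] at h1
    have h3 : |x₀ - a.re| - |w.re - x₀| ≤ |w.re - a.re| := by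
      have := abs_sub_abs_le_abs_sub (x₀ - a.re) (x₀ - w.re)
      rw [show x₀ - a.re - (x₀ - w.re) = w.re - a.re by ring, abs_sub_comm x₀ w.re] at this
      exact this
    linarith [hout a ha]
  have h := XiDerivStrip.im_mul_im_logDeriv_neg hf hρ0 hρ hgr hreal hex hwim.ne' hout'
  by_contra hge
  push Not at hge
  have := mul_nonneg hwim.le hge
  linarith

/-- `f″` is real on the real axis. -/
theorem im_deriv_deriv_ofReal (hf : Differentiable ℂ f) (hreal : ∀ x : ℝ, (f x).im = 0)
    (x : ℝ) : (deriv (deriv f) x).im = 0 := by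
  have hdf : Differentiable ℂ (deriv f) := by
    simpa [iteratedDeriv_one] using differentiable_iteratedDeriv_of_entire hf 1
  exact im_deriv_ofReal hdf (im_deriv_ofReal hf hreal) x

/-- **Strict Laguerre inequality at a real point with a Jensen margin**: under the hypotheses of
`eventually_im_logDeriv_neg` and `f(x₀) ≠ 0`, `f(x₀) f″(x₀) < f′(x₀)²` (real parts; all three values
are real).  (Boas 1954, Thm 2.8.2, localised: `(f′/f)′ = (f″f − f′²)/f² < 0` at `x₀`.) -/
theorem laguerre_strict_of_margin (hf : Differentiable ℂ f) {ρ C : ℝ} (hρ0 : 0 ≤ ρ) (hρ : ρ < 2)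
    (hgr : ∀ z, ‖f z‖ ≤ C * Real.exp (‖z‖ ^ ρ)) (hreal : ∀ x : ℝ, (f x).im = 0)
    (hex : ∃ a, f a = 0) {x₀ δ : ℝ} (hδ : 0 < δ)
    (hout : ∀ a, f a = 0 → |a.im| + δ ≤ |x₀ - a.re|) (hx : f x₀ ≠ 0) :
    (f x₀).re * (deriv (deriv f) x₀).re < (deriv f x₀).re ^ 2 := by
  obtain ⟨hneg, -⟩ := re_deriv_logDeriv_neg_of_eventually hf hreal hx
    (eventually_im_logDeriv_neg hf hρ0 hρ hgr hreal hex hδ hout)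
  have hdf : DifferentiableAt ℂ (deriv f) x₀ := (hf.analyticAt _).deriv.differentiableAt
  have hd : deriv (fun z ↦ deriv f z / f z) x₀ =
      (deriv (deriv f) x₀ * f x₀ - deriv f x₀ * deriv f x₀) / f x₀ ^ 2 := deriv_div hdf (hf x₀) hx
  set a : ℝ := (f x₀).re
  set b : ℝ := (deriv f x₀).re
  set c : ℝ := (deriv (deriv f) x₀).re
  have hfx : f x₀ = (a : ℂ) := Complex.ext (by simp [a]) (by simp [hreal x₀])
  have hf'x : deriv f x₀ = (b : ℂ) :=
    Complex.ext (by simp [b]) (by simp [im_deriv_ofReal hf hreal x₀])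
  have hf''x : deriv (deriv f) x₀ = (c : ℂ) :=
    Complex.ext (by simp [c]) (by simp [im_deriv_deriv_ofReal hf hreal x₀])
  have ha : a ≠ 0 := fun h ↦ hx (by rw [hfx, h]; simp)
  rw [hd, hfx, hf'x, hf''x, show ((c : ℂ) * a - b * b) / (a : ℂ) ^ 2 = (((c * a - b * b) / a ^ 2 : ℝ) : ℂ)
    by push_cast; ring, Complex.ofReal_re, div_lt_iff₀ (by positivity), zero_mul] at hneg
  nlinarith

/-! ## §2. `Ξ`: the uniform Jensen margin and the item -/

/-- **Uniform Jensen margin for `Ξ`.**  If `c ∈ ℝ`, `Ξ(c) ≠ 0`, and `c` lies strictly outside the closed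
Jensen disc of every non-real zero of `Ξ` (`|Im ρ| < |c − Re ρ|`), then there is `δ > 0` with
`|Im a| + δ ≤ |c − Re a|` for EVERY zero `a` of `Ξ`.  (The zeros have `|Im a| < ½`; those with
`‖a − c‖ ≤ 2` form a compact set on which the continuous margin `|c − Re a| − |Im a|` is positive, the
others have margin `> 1`.) -/
theorem exists_margin_riemannXiUpper {c : ℝ} (hc : riemannXiUpper c ≠ 0)
    (hdisc : ∀ ρ : ℂ, riemannXiUpper ρ = 0 → ρ.im ≠ 0 → |ρ.im| < |c - ρ.re|) :
    ∃ δ : ℝ, 0 < δ ∧ ∀ a : ℂ, riemannXiUpper a = 0 → |a.im| + δ ≤ |c - a.re| := by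
  set φ : ℂ → ℝ := fun a ↦ |c - a.re| - |a.im| with hφ
  have hφc : Continuous φ := by
    simp only [hφ]
    fun_prop
  -- positivity of the margin at every zero
  have hpos : ∀ a, riemannXiUpper a = 0 → 0 < φ a := by
    intro a ha
    simp only [hφ]
    by_cases him : a.im = 0
    · have hare : a = ((a.re : ℝ) : ℂ) := Complex.ext (by simp) (by simp [him])
      have hne : a.re ≠ c := by
        intro h
        apply hc
        rw [← h, ← hare]
        exact ha
      rw [him, abs_zero, sub_zero, abs_pos, sub_ne_zero]
      exact fun h ↦ hne h.symm
    · have := hdisc a ha him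
      linarith
  set K : Set ℂ := {a | riemannXiUpper a = 0} ∩ closedBall (c : ℂ) 2 with hK
  have hKc : IsCompact K :=
    (isCompact_closedBall (c : ℂ) 2).inter_left
      (isClosed_eq XiDerivStrip.differentiable_xiUpper.continuous continuous_const)
  -- a positive lower bound of `φ` on `K`
  have hlb : ∃ δ₀ : ℝ, 0 < δ₀ ∧ ∀ a ∈ K, δ₀ ≤ φ a := by
    rcases K.eq_empty_or_nonempty with hKe | hKne
    · exact ⟨1, one_pos, fun a ha ↦ by rw [hKe] at ha; exact absurd ha (Set.notMem_empty a)⟩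
    · obtain ⟨a₀, ha₀K, hmin⟩ := hKc.exists_isMinOn hKne hφc.continuousOn
      exact ⟨φ a₀, hpos a₀ ha₀K.1, fun a ha ↦ hmin ha⟩
  obtain ⟨δ₀, hδ₀, hδ₀le⟩ := hlb
  refine ⟨min δ₀ 1, lt_min hδ₀ one_pos, fun a ha ↦ ?_⟩
  by_cases hball : a ∈ closedBall (c : ℂ) 2
  · have h1 := hδ₀le a ⟨ha, hball⟩
    simp only [hφ] at h1
    have := min_le_left δ₀ 1
    linarith
  · -- far zeros: `‖a − c‖ > 2` and `|Im a| < ½` give `|c − Re a| > 3/2`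
    have hfar : 2 < ‖a - (c : ℂ)‖ := by
      rw [mem_closedBall_iff_norm, not_le] at hball; exact hball
    have him : |a.im| < 1 / 2 := abs_im_lt_half_of_riemannXiUpper_eq_zero ha
    have hdecomp : ‖a - (c : ℂ)‖ ≤ |a.re - c| + |a.im| := by
      have e : a - (c : ℂ) = ((a.re - c : ℝ) : ℂ) + (a.im : ℂ) * I := by
        apply Complex.ext <;> simp
      rw [e]
      calc ‖(((a.re - c : ℝ) : ℂ) + (a.im : ℂ) * I)‖ ≤ ‖((a.re - c : ℝ) : ℂ)‖ + ‖(a.im : ℂ) * I‖ :=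
            norm_add_le _ _
        _ = |a.re - c| + |a.im| := by
            rw [norm_mul, Complex.norm_I, mul_one, Complex.norm_real, Complex.norm_real,
              Real.norm_eq_abs, Real.norm_eq_abs]
    rw [abs_sub_comm] at hdecomp
    have := min_le_right δ₀ 1
    linarith

/-- The real derivative of `u ↦ Re Ξ(u)` is `Re Ξ′(u)`. -/
theorem deriv_re_riemannXiUpper_eq :
    deriv (fun u : ℝ => (riemannXiUpper (u : ℂ)).re) = fun u : ℝ => (deriv riemannXiUpper (u : ℂ)).re :=
  funext fun _ ↦ (XiDerivStrip.differentiable_xiUpper.differentiableAt.hasDerivAt.real_of_complex).deriv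

/-- The second real derivative of `u ↦ Re Ξ(u)` is `Re Ξ″(u)`. -/
theorem iteratedDeriv_two_re_riemannXiUpper_eq (c : ℝ) :
    iteratedDeriv 2 (fun u : ℝ => (riemannXiUpper (u : ℂ)).re) c =
      (deriv (deriv riemannXiUpper) (c : ℂ)).re := by
  have hd : Differentiable ℂ (deriv riemannXiUpper) := by
    simpa [iteratedDeriv_one] using
      differentiable_iteratedDeriv_of_entire XiDerivStrip.differentiable_xiUpper 1
  rw [show (2 : ℕ) = 1 + 1 from rfl, iteratedDeriv_succ, iteratedDeriv_one, deriv_re_riemannXiUpper_eq]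
  exact (hd.differentiableAt.hasDerivAt.real_of_complex).deriv

/-- **Strict Laguerre inequality for `Ξ` outside the Jensen discs (RH-free).**  If `c ∈ ℝ`, `Ξ(c) ≠ 0`,
and `|Im ρ| < |c − Re ρ|` for every non-real zero `ρ` of `Ξ`, then
`Re Ξ(c) · Re Ξ″(c) < (Re Ξ′(c))²`. -/
theorem laguerre_strict_riemannXiUpper_of_outside_discs {c : ℝ} (hc : riemannXiUpper c ≠ 0)
    (hdisc : ∀ ρ : ℂ, riemannXiUpper ρ = 0 → ρ.im ≠ 0 → |ρ.im| < |c - ρ.re|) :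
    (riemannXiUpper c).re * (deriv (deriv riemannXiUpper) c).re < (deriv riemannXiUpper c).re ^ 2 := by
  obtain ⟨δ, hδ, hout⟩ := exists_margin_riemannXiUpper hc hdisc
  obtain ⟨ρ, C, hρ0, hρ, hgr⟩ := exists_growth_riemannXiUpper
  have hex : ∃ a, riemannXiUpper a = 0 := by
    simpa using exists_iteratedDeriv_riemannXiUpper_eq_zero 0
  exact laguerre_strict_of_margin XiDerivStrip.differentiable_xiUpper hρ0 hρ hgr
    im_riemannXiUpper_ofReal_holds hex hδ hout hc

end DipInJensenDisc

open Literature.NumberTheory.LFunctions in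
/-- **Item `DipInJensenDisc` (stmt-RiemannHypothesis-23303, route `LaguerreSpeiserSplit`; RH-free).**
«A non-crossing dip is shadowed»: if `c ∈ ℝ` is a critical point of `t ↦ Re Ξ(t)` with `Ξ(c) ≠ 0` and
the wrong Laguerre sign `Re Ξ(c) · (Re Ξ)″(c) ≥ 0`, then some NON-REAL zero `ρ` of `Ξ` has `c` in its
closed Jensen disc, `|c − Re ρ| ≤ |Im ρ|` (`< ½`).  Real-axis form of Jensen's circle theorem /
Laguerre's inequality (Jensen 1913; Ki–Kim 2000 §2; Boas 1954 Thm 2.8.1; Csordas–Ruttan–Varga 1991).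
The type is the item's signature verbatim.  Nothing here bears on the truth of RH. -/
theorem dipInJensenDisc :
    ∀ c : ℝ, deriv (fun u : ℝ => (riemannXiUpper (u : ℂ)).re) c = 0 →
      (riemannXiUpper (c : ℂ)).re ≠ 0 →
      0 ≤ (riemannXiUpper (c : ℂ)).re *
        iteratedDeriv 2 (fun u : ℝ => (riemannXiUpper (u : ℂ)).re) c →
      ∃ ρ : ℂ, riemannXiUpper ρ = 0 ∧ ρ.im ≠ 0 ∧ |c - ρ.re| ≤ |ρ.im| := by
  intro c hc1 hc0 hsign
  by_contra hcon
  push Not at hcon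
  have hc : riemannXiUpper c ≠ 0 := fun h ↦ hc0 (by rw [h]; simp)
  have hlag := DipInJensenDisc.laguerre_strict_riemannXiUpper_of_outside_discs hc hcon
  have h1 : (deriv riemannXiUpper (c : ℂ)).re = 0 := by
    have := congrFun DipInJensenDisc.deriv_re_riemannXiUpper_eq c
    rw [← this]; exact hc1
  rw [DipInJensenDisc.iteratedDeriv_two_re_riemannXiUpper_eq] at hsign
  rw [h1] at hlag
  linarith

end Summit.RiemannHypothesis.RiemannHypothesis.Theorems

end
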